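import Summits.ValiantsHypothesis.ValiantsHypothesis.Theorems.LacunarySymmetroidMatrixDescartesNsdPivotLoneLadder

/-!
# `MatrixDescartes` (stmt-ValiantsHypothesis-18050) — THE OBLIQUE PARALLEL CLUSTER: a DESIGNED `(1 | K−1)` NSD family with a
# rank-one lone letter and `2K − 2` positive roots FOR EVERY `K` (persistence + domination induction; no hunting)

HONEST FRAMING.  Cell `pub-symmetroid`, seat `val-sym-mdr-p2` (gen 29); helper file `--supports` the crux
`Theses.LacunarySymmetroid.MatrixDescartes` (OPEN), NO closure claim.  Context: the `2 × 2` NSD-pivot rows on the support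
`(1 | K−1)` (one PSD letter strictly below the pivot exponent, `K − 1` strictly above).  With a RANK-ONE lone letter the tree has the
END-LAW ceiling `2K − 1` (gen 27, `NsdLoneRankOne.pivotPosRoots_succ_le_of_lone_below`), the exact values `5` (`K = 3`) and `7`
(`K = 4`, gen 28, found by seeded hunting in `10⁻⁴`-windows), and for `K ≥ 5` only the CONSTANT floor `7`
(`NsdLoneLadder.loneBelow_rankOne_bracket`: `[7, 2K − 1]`; every `K = 5` hunt of gens 27–28 stopped at `7`).

THIS FILE replaces hunting by a DESIGN.  Take the pivot `−1` at exponent `1`, the rank-one lone letter `(1,1)(1,1)ᵀ` at exponent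
`0`, and `F = K − 1` upper letters `A_k t^{D_k} e₂e₂ᵀ` — all RANK ONE and mutually PARALLEL, along a direction OBLIQUE to the lone
letter (the «oblique parallel cluster»).  Then (`eval_det_design`)
    `det F(t) = (1 − t)·q(t) − t(2 − t)`,   `q(t) = ∑ₖ A_k t^{D_k}`,
so the positive roots are the solutions of `q(t) = t(2 − t)/(1 − t) = 2t + t² + t³ + ⋯` on `(0, 1)`: a positive `K−1`-nomial against
a FIXED power series with positive coefficients.  (Heuristic behind the design, not used in the proofs: in `s = log t` the target is
exponentially convex, so by the Chebyshev–Markov–Krein moment geometry a positive exponential sum with `F` atoms can interpolate it at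
`2F` points — the Descartes bound `2F` of this sign pattern is ATTAINED.  The orthogonal parallel cluster of gen 28's memo CASCADE §4
decouples instead; obliqueness is what couples the cluster to the lone letter.)  The kernel proof is an explicit induction on `F`
(`design_invariant`): given `2F` certified alternating signs at points `ρ_j < 1` (and `det F(1) = −1` for every member of the
family), add one letter `a tⁿ e₂e₂ᵀ`; its contribution `a tⁿ(1 − t)` is made DOMINANT at a fresh point `σ₁ ∈ (ρ, 1)` and, for `n`
large, NEGLIGIBLE at every old point and at a fresh `σ₀ ∈ (ρ, σ₁)` where the old determinant is negative (continuity at `1`):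
two more sign changes, all margins explicit (`Filter.eventually_all` over the finitely many old points, `(ρ_j/σ₁)ⁿ → 0`).
Consequences (`exists_rankOne_design`): for every `F` a GENUINE member of the rank-one-lone `(1 | F)` NSD class (non-zero rank-one
letters, pairwise distinct exponents `0 | 1 | D_k ≥ 2`) with `Z₊ ≥ 2F = 2K − 2`.  The row consequences — the rank-one-lone row is
`2K − 2` or `2K − 1` for EVERY `K`, the free-lone row `2K − 1` or `2K`, `K = 5`: `8` or `9` — are filed in the companion
`…NsdPivotLoneParallelRows`.  The exponents of the design grow geometrically (each new letter lives closer to `t = 1`), which is why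
exponent-capped hunts never saw it.  Nothing here bears on `MatrixDescartes` in its window, on `DoorA26` / `DoorA34`, on the cell's
registers beyond the `(1 | K−1)` NSD sub-rows, or on `VP ≠ VNP`.

[folklore] Intermediate value theorem at rational/real points (`Pivot.le_pivotPosRoots_of_certificate`), `rⁿ → 0` for `0 ≤ r < 1`
(`tendsto_pow_atTop_nhds_zero_of_lt_one`); the design and the induction are this seat's (gen 29).
-/

set_option linter.dupNamespace false

namespace Summit.ValiantsHypothesis.ValiantsHypothesis.Theorems.LacunarySymmetroidMatrixDescartes.Pivot.NsdLoneParallelDesign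

open Polynomial Matrix Finset Filter Topology
open scoped BigOperators

/-! ## 1. The design and its determinant -/

/-- **The determinant of the design.**  Pivot `−1` (the `2 × 2` identity, negated) at exponent `1`; lone letter
`!![1, 1; 1, 1 + δ]` at exponent `0`; upper letters `!![0, 0; 0, A k]` (all parallel to `e₂`) at exponents `D k`:
`det F(t) = (1 − t)·∑ₖ t^{D k} A k − t (2 − t) + δ (1 − t)`. [folklore] -/
theorem eval_det_design {F : ℕ} (D : Fin F → ℕ) (A : Fin F → ℝ) (δ t : ℝ) :
    (t ^ 1 • (!![(-1 : ℝ), 0; 0, -1] : Matrix (Fin 2) (Fin 2) ℝ)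
      + ∑ k, t ^ (Fin.cons 0 D : Fin (F + 1) → ℕ) k •
        (Fin.cons (!![(1 : ℝ), 1; 1, 1 + δ]) (fun k => !![(0 : ℝ), 0; 0, A k]) : Fin (F + 1) → Matrix (Fin 2) (Fin 2) ℝ) k).det
      = (1 - t) * (∑ k, t ^ D k * A k) - t * (2 - t) + δ * (1 - t) := by
  rw [Matrix.det_fin_two]
  simp [Matrix.add_apply, Matrix.sum_apply, Fin.sum_univ_succ]
  ring

/-! ## 2. Elementary analysis used by the induction -/

/-- Sign persistence: a perturbation smaller in absolute value than the value keeps the certified sign. [folklore] -/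
theorem sign_persists {j : ℕ} {x y : ℝ} (hx : 0 < (-1 : ℝ) ^ j * x) (hy : |y| < |x|) :
    0 < (-1 : ℝ) ^ j * (x + y) := by
  rcases neg_one_pow_eq_or ℝ j with h | h <;> rw [h] at hx ⊢
  · rw [one_mul] at hx ⊢
    rw [abs_of_pos hx] at hy
    have := neg_abs_le y
    linarith
  · rw [neg_one_mul] at hx ⊢
    rw [abs_of_neg (by linarith : x < 0)] at hy
    have := le_abs_self y
    linarith

/-- Consecutive certified signs alternate. [folklore] -/
theorem mul_neg_of_signs {j : ℕ} {x y : ℝ} (hx : 0 < (-1 : ℝ) ^ j * x) (hy : 0 < (-1 : ℝ) ^ (j + 1) * y) :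
    x * y < 0 := by
  have h := mul_pos hx hy
  have h1 : ((-1 : ℝ) ^ j) * ((-1 : ℝ) ^ j) = 1 := by
    rw [← mul_pow]; norm_num
  have h2 : (-1 : ℝ) ^ j * x * ((-1 : ℝ) ^ (j + 1) * y) = -(((-1 : ℝ) ^ j * (-1 : ℝ) ^ j) * (x * y)) := by ring
  rw [h2, h1, one_mul] at h
  linarith

/-- `C · (x / y)ⁿ → 0` beats any positive margin for `0 ≤ x < y`. [folklore] -/
theorem eventually_lt_margin {x y M : ℝ} (C : ℝ) (hx : 0 ≤ x) (hxy : x < y) (hM : 0 < M) :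
    ∀ᶠ n : ℕ in atTop, C * (x / y) ^ n < M := by
  have hy : 0 < y := hx.trans_lt hxy
  have h0 : 0 ≤ x / y := div_nonneg hx hy.le
  have h1 : x / y < 1 := (div_lt_one hy).mpr hxy
  have ht : Tendsto (fun n : ℕ => C * (x / y) ^ n) atTop (𝓝 (C * 0)) :=
    (tendsto_pow_atTop_nhds_zero_of_lt_one h0 h1).const_mul C
  rw [mul_zero] at ht
  exact ht.eventually_lt_const hM

/-- Prepending a larger value to a strictly decreasing tuple keeps it strictly decreasing. [folklore] -/
theorem strictAnti_cons {n : ℕ} {f : Fin n → ℝ} (hf : StrictAnti f) {a : ℝ} (ha : ∀ j, f j < a) :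
    StrictAnti (Fin.cons a f : Fin (n + 1) → ℝ) := by
  intro i j hij
  cases i using Fin.cases with
  | zero =>
    cases j using Fin.cases with
    | zero => exact absurd hij (lt_irrefl _)
    | succ j' => simpa using ha j'
  | succ i' =>
    cases j using Fin.cases with
    | zero => exact absurd hij (Fin.not_lt_zero _)
    | succ j' => simpa using hf (Fin.succ_lt_succ_iff.mp hij)

/-- Prepending a smaller value to a strictly increasing tuple keeps it strictly increasing. [folklore] -/
theorem strictMono_cons {n : ℕ} {f : Fin n → ℝ} (hf : StrictMono f) {a : ℝ} (ha : ∀ j, a < f j) :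
    StrictMono (Fin.cons a f : Fin (n + 1) → ℝ) := by
  intro i j hij
  cases i using Fin.cases with
  | zero =>
    cases j using Fin.cases with
    | zero => exact absurd hij (lt_irrefl _)
    | succ j' => simpa using ha j'
  | succ i' =>
    cases j using Fin.cases with
    | zero => exact absurd hij (Fin.not_lt_zero _)
    | succ j' => simpa using hf (Fin.succ_lt_succ_iff.mp hij)

/-! ## 3. The induction: `F` parallel upper letters give `2F` certified sign alternations below `t = 1` -/

/-- **The inductive design (decreasing certificate).**  For every `F` there are exponents `D k ≥ 2` (pairwise distinct), amplitudes
`A k > 0` and `2F` points `1 > ρ 0 > ρ 1 > ⋯ > ρ (2F−1) > 0` at which `f_F(t) = (1 − t)·∑ₖ t^{D k} A k − t(2 − t)` has the signs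
`+, −, +, −, …` (and `f_F(1) = −1`).  Step `F → F + 1`: pick `σ₀ ∈ (ρ 0, 1)` with `f_F(σ₀) < 0` (continuity at `1`), `σ₁ = (σ₀ + 1)/2`,
a new letter `a tⁿ` with `a σ₁ⁿ (1 − σ₁) = 2(|f_F(σ₁)| + 1)` and `n` so large that `a tⁿ (1 − t) < |f_F(t)|` at `σ₀` and every `ρ j`
(all `≤ σ₀ < σ₁`). [folklore] -/
theorem design_invariant (F : ℕ) :
    ∃ (D : Fin F → ℕ) (A : Fin F → ℝ) (ρ : Fin (2 * F) → ℝ) (M : ℝ),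
      StrictAnti D ∧ (∀ k, 2 ≤ D k) ∧ (∀ k, 0 < A k) ∧ StrictAnti ρ ∧ (∀ j, 0 < ρ j) ∧ (∀ j, ρ j ≤ M) ∧ 0 ≤ M ∧ M < 1 ∧
      ∀ j : Fin (2 * F), 0 < (-1 : ℝ) ^ (j : ℕ) * ((1 - ρ j) * (∑ k, ρ j ^ D k * A k) - ρ j * (2 - ρ j)) := by
  induction F with
  | zero =>
    exact ⟨Fin.elim0, Fin.elim0, Fin.elim0, 0, fun i => i.elim0, fun k => k.elim0, fun k => k.elim0, fun i => i.elim0,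
      fun j => j.elim0, fun j => j.elim0, le_rfl, zero_lt_one, fun j => j.elim0⟩
  | succ F ih =>
    obtain ⟨D, A, ρ, M, hD, hD2, hA, hρ, hρ0, hρM, hM0, hM1, hsign⟩ := ih
    -- the old determinant as a function
    set f : ℝ → ℝ := fun t => (1 - t) * (∑ k, t ^ D k * A k) - t * (2 - t) with hf
    have hfc : Continuous f := by
      rw [hf]; fun_prop
    have hf1 : f 1 = -1 := by simp [hf]; norm_num
    -- σ₀ ∈ (M, 1) with f σ₀ < 0
    obtain ⟨σ₀, hσ₀f, hMσ₀, hσ₀1⟩ : ∃ σ₀, f σ₀ < 0 ∧ M < σ₀ ∧ σ₀ < 1 := by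
      have h1 : ∀ᶠ t in 𝓝[<] (1 : ℝ), f t < 0 :=
        nhdsWithin_le_nhds ((hfc.tendsto 1).eventually_lt_const (by rw [hf1]; norm_num))
      have h2 : ∀ᶠ t in 𝓝[<] (1 : ℝ), t ∈ Set.Ioo M 1 := Ioo_mem_nhdsLT hM1
      obtain ⟨σ₀, h, hI⟩ := (h1.and h2).exists
      exact ⟨σ₀, h, hI.1, hI.2⟩
    have hσ₀0 : 0 < σ₀ := hM0.trans_lt hMσ₀
    set σ₁ : ℝ := (σ₀ + 1) / 2 with hσ₁
    have hσ₀σ₁ : σ₀ < σ₁ := by rw [hσ₁]; linarith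
    have hσ₁1 : σ₁ < 1 := by rw [hσ₁]; linarith
    have hσ₁0 : 0 < σ₁ := hσ₀0.trans hσ₀σ₁
    have hσ₁ne : 1 - σ₁ ≠ 0 := (sub_pos.mpr hσ₁1).ne'
    clear_value σ₁
    -- the margin constant and the eventual choice of the new exponent
    set C : ℝ := 2 * (|f σ₁| + 1) / (1 - σ₁) with hC
    have hC0 : 0 < C := by rw [hC]; exact div_pos (by positivity) (by linarith)
    -- all old certificate points together with σ₀
    set ρp : Fin (2 * F + 1) → ℝ := Fin.cons σ₀ ρ with hρp
    have hρple : ∀ i, ρp i ≤ σ₀ := by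
      intro i; cases i using Fin.cases with
      | zero => simp [hρp]
      | succ i' => simpa [hρp] using (hρM i').trans hMσ₀.le
    have hρppos : ∀ i, 0 < ρp i := by
      intro i; cases i using Fin.cases with
      | zero => simpa [hρp] using hσ₀0
      | succ i' => simpa [hρp] using hρ0 i'
    have hρpne : ∀ i, f (ρp i) ≠ 0 := by
      intro i; cases i using Fin.cases with
      | zero => simpa [hρp] using hσ₀f.ne
      | succ i' =>
        have h := hsign i'
        simp only [hρp, Fin.cons_succ]
        intro h0
        rw [show (1 - ρ i') * (∑ k, ρ i' ^ D k * A k) - ρ i' * (2 - ρ i') = f (ρ i') from rfl, h0, mul_zero] at h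
        exact lt_irrefl _ h
    have hev : ∀ᶠ n : ℕ in atTop, (∀ i, C * (ρp i / σ₁) ^ n < |f (ρp i)|) ∧ (∀ k, D k < n) ∧ 2 ≤ n := by
      refine (eventually_all.2 fun i => ?_).and ((eventually_all.2 fun k => eventually_gt_atTop (D k)).and
        (eventually_ge_atTop 2))
      exact eventually_lt_margin C (hρppos i).le ((hρple i).trans_lt hσ₀σ₁) (abs_pos.mpr (hρpne i))
    obtain ⟨n, hnmargin, hnD, hn2⟩ := hev.exists
    -- the new amplitude
    set a : ℝ := 2 * (|f σ₁| + 1) / (σ₁ ^ n * (1 - σ₁)) with ha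
    have ha0 : 0 < a := by rw [ha]; exact div_pos (by positivity) (mul_pos (by positivity) (by linarith))
    -- the new determinant is the old one plus the bump `a tⁿ (1 − t)`
    have hnew : ∀ t : ℝ, (1 - t) * (∑ k, t ^ (Fin.cons n D : Fin (F + 1) → ℕ) k * (Fin.cons a A : Fin (F + 1) → ℝ) k)
        - t * (2 - t) = f t + (1 - t) * (a * t ^ n) := by
      intro t
      simp only [hf, Fin.sum_univ_succ, Fin.cons_zero, Fin.cons_succ]
      ring
    -- size of the bump at the old points
    have hbump : ∀ i, |(1 - ρp i) * (a * ρp i ^ n)| < |f (ρp i)| := by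
      intro i
      refine lt_of_le_of_lt ?_ (hnmargin i)
      have h1 : 0 ≤ 1 - ρp i := by linarith [hρple i, hσ₀1]
      rw [abs_of_nonneg (mul_nonneg h1 (mul_nonneg ha0.le (pow_nonneg (hρppos i).le _)))]
      have hE : (1 - ρp i) * (a * ρp i ^ n) = C * (ρp i / σ₁) ^ n * (1 - ρp i) := by
        rw [ha, hC, div_pow]
        have : σ₁ ^ n ≠ 0 := pow_ne_zero _ hσ₁0.ne'
        field_simp
      rw [hE]
      have h2 : 0 ≤ C * (ρp i / σ₁) ^ n := mul_nonneg hC0.le (pow_nonneg (div_nonneg (hρppos i).le hσ₁0.le) _)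
      have h3 : 1 - ρp i ≤ 1 := by linarith [hρppos i]
      nlinarith
    refine ⟨Fin.cons n D, Fin.cons a A, (Fin.cons σ₁ (Fin.cons σ₀ ρ) : Fin (2 * F + 2) → ℝ), σ₁,
      ?_, ?_, ?_, ?_, ?_, ?_, hσ₁0.le, hσ₁1, ?_⟩
    · -- exponents strictly decreasing
      refine fun i j hij => ?_
      cases i using Fin.cases with
      | zero =>
        cases j using Fin.cases with
        | zero => exact absurd hij (lt_irrefl _)
        | succ j' => simpa using hnD j'
      | succ i' =>
        cases j using Fin.cases with
        | zero => exact absurd hij (Fin.not_lt_zero _)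
        | succ j' => simpa using hD (Fin.succ_lt_succ_iff.mp hij)
    · intro k; cases k using Fin.cases with
      | zero => simpa using hn2
      | succ k' => simpa using hD2 k'
    · intro k; cases k using Fin.cases with
      | zero => simpa using ha0
      | succ k' => simpa using hA k'
    · refine strictAnti_cons (strictAnti_cons hρ fun j => (hρM j).trans_lt hMσ₀) fun j => ?_
      cases j using Fin.cases with
      | zero => simpa using hσ₀σ₁
      | succ j' => simpa using ((hρM j').trans_lt hMσ₀).trans hσ₀σ₁
    · intro j; cases j using Fin.cases with
      | zero => simpa using hσ₁0
      | succ j' =>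
        cases j' using Fin.cases with
        | zero => simpa using hσ₀0
        | succ j'' => simpa using hρ0 j''
    · intro j; cases j using Fin.cases with
      | zero => simp
      | succ j' =>
        cases j' using Fin.cases with
        | zero => simpa using hσ₀σ₁.le
        | succ j'' => simpa using ((hρM j'').trans hMσ₀.le).trans hσ₀σ₁.le
    · intro j
      rw [hnew]
      cases j using Fin.cases with
      | zero =>
        -- the dominating point σ₁: `f σ₁ + 2(|f σ₁| + 1) > 0`
        simp only [Fin.cons_zero, Fin.val_zero, pow_zero, one_mul]
        have h : (1 - σ₁) * (a * σ₁ ^ n) = 2 * (|f σ₁| + 1) := by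
          rw [ha]; field_simp
        rw [h]
        have := neg_abs_le (f σ₁)
        have := abs_nonneg (f σ₁)
        linarith
      | succ j' =>
        cases j' using Fin.cases with
        | zero =>
          -- σ₀: old value negative, bump smaller than its size
          simp only [Fin.cons_succ, Fin.cons_zero, Fin.val_succ, Fin.val_zero, zero_add, pow_one]
          have hb := hbump 0
          simp only [hρp, Fin.cons_zero] at hb
          have h0 : 0 < (-1 : ℝ) ^ 1 * f σ₀ := by simpa using hσ₀f
          simpa using sign_persists h0 hb
        | succ j'' =>
          simp only [Fin.cons_succ, Fin.val_succ]
          have hb := hbump j''.succ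
          simp only [hρp, Fin.cons_succ] at hb
          rw [show (j'' : ℕ) + 1 + 1 = (j'' : ℕ) + 2 from rfl, pow_add, show ((-1 : ℝ) ^ 2) = 1 by norm_num, mul_one]
          exact sign_persists (hsign j'') hb

/-! ## 4. The increasing signed certificate (anchor `t = 1` included) -/

/-- A signed certificate at consecutive indices gives a strict sign alternation. [folklore] -/
theorem alternate_of_signed {N : ℕ} {g : ℝ → ℝ} {τ : Fin (N + 1) → ℝ}
    (h : ∀ i : Fin (N + 1), (-1 : ℝ) ^ (i : ℕ) * g (τ i) < 0) (j : Fin N) :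
    g (τ j.castSucc) * g (τ j.succ) < 0 := by
  have h1 : 0 < (-1 : ℝ) ^ (j : ℕ) * (-g (τ j.castSucc)) := by
    have := h j.castSucc; simp only [Fin.val_castSucc] at this; linarith
  have h2 : 0 < (-1 : ℝ) ^ ((j : ℕ) + 1) * (-g (τ j.succ)) := by
    have := h j.succ; simp only [Fin.val_succ] at this; linarith
  have := mul_neg_of_signs h1 h2
  linarith

/-- **The signed certificate of the design, increasing form.**  For every `F`: exponents `D` (strictly decreasing, all `≥ 2`),
amplitudes `A > 0` and `2F + 1` points `0 < τ 0 < ⋯ < τ (2F) = 1` (all `≤ 1`) with `(−1)^i f_F(τ i) < 0` — `2F` sign changes of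
`f_F(t) = (1 − t)·∑ₖ t^{D k} A k − t(2 − t)` on `(0, 1]`. [folklore] -/
theorem exists_signed_certificate (F : ℕ) :
    ∃ (D : Fin F → ℕ) (A : Fin F → ℝ) (τ : Fin (2 * F + 1) → ℝ),
      StrictAnti D ∧ (∀ k, 2 ≤ D k) ∧ (∀ k, 0 < A k) ∧ StrictMono τ ∧ (∀ i, 0 < τ i) ∧ (∀ i, τ i ≤ 1) ∧
      ∀ i : Fin (2 * F + 1), (-1 : ℝ) ^ (i : ℕ) * ((1 - τ i) * (∑ k, τ i ^ D k * A k) - τ i * (2 - τ i)) < 0 := by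
  obtain ⟨D, A, ρ, M, hD, hD2, hA, hρ, hρ0, hρM, _, hM1, hsign⟩ := design_invariant F
  have hc_anti : StrictAnti (Fin.cons 1 ρ : Fin (2 * F + 1) → ℝ) := strictAnti_cons hρ fun j => (hρM j).trans_lt hM1
  -- facts about the decreasing tuple `1, ρ 0, ρ 1, …`, index by index
  have hpos : ∀ m, 0 < (Fin.cons 1 ρ : Fin (2 * F + 1) → ℝ) m := fun m => by
    cases m using Fin.cases with
    | zero => simp
    | succ j => simpa using hρ0 j
  have hle : ∀ m, (Fin.cons 1 ρ : Fin (2 * F + 1) → ℝ) m ≤ 1 := fun m => by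
    cases m using Fin.cases with
    | zero => simp
    | succ j => simpa using (hρM j).trans hM1.le
  have hsg : ∀ m : Fin (2 * F + 1), (-1 : ℝ) ^ (m : ℕ) * ((1 - (Fin.cons 1 ρ : Fin (2 * F + 1) → ℝ) m)
      * (∑ k, (Fin.cons 1 ρ : Fin (2 * F + 1) → ℝ) m ^ D k * A k)
      - (Fin.cons 1 ρ : Fin (2 * F + 1) → ℝ) m * (2 - (Fin.cons 1 ρ : Fin (2 * F + 1) → ℝ) m)) < 0 := fun m => by
    cases m using Fin.cases with
    | zero => norm_num
    | succ j =>
      simp only [Fin.cons_succ, Fin.val_succ, pow_succ]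
      have := hsign j
      linarith
  refine ⟨D, A, fun i => (Fin.cons 1 ρ : Fin (2 * F + 1) → ℝ) (Fin.rev i), hD, hD2, hA,
    hc_anti.comp Fin.rev_strictAnti, fun i => hpos _, fun i => hle _, fun i => ?_⟩
  -- parity: `i + rev i = 2F`, so `(−1)^i = (−1)^{rev i}`
  have hpar : (-1 : ℝ) ^ (i : ℕ) = (-1) ^ ((Fin.rev i : Fin (2 * F + 1)) : ℕ) := by
    have hsum : (i : ℕ) + ((Fin.rev i : Fin (2 * F + 1)) : ℕ) = 2 * F := by
      rw [Fin.val_rev]; omega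
    have h1 : (-1 : ℝ) ^ (i : ℕ) * (-1) ^ ((Fin.rev i : Fin (2 * F + 1)) : ℕ) = 1 := by
      rw [← pow_add, hsum, pow_mul]; norm_num
    rcases neg_one_pow_eq_or ℝ ((Fin.rev i : Fin (2 * F + 1)) : ℕ) with h | h <;> rw [h] at h1 ⊢ <;> linarith
  rw [hpar]
  exact hsg _

/-! ## 5. The pencils: `2K − 2` positive roots in the rank-one-lone `(1 | K−1)` NSD class, for every `K` -/

/-- `−J = 1 ⪰ 0` for the pivot `J = −1`. [folklore] -/
theorem neg_J_posSemidef : (-(!![(-1 : ℝ), 0; 0, -1] : Matrix (Fin 2) (Fin 2) ℝ)).PosSemidef := by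
  rw [show (-(!![(-1 : ℝ), 0; 0, -1] : Matrix (Fin 2) (Fin 2) ℝ)) = !![(1 : ℝ), 0; 0, 1] from by
    ext i j; fin_cases i <;> fin_cases j <;> simp]
  exact PivotTwoFourWitness.posSemidef_two_of_entries 1 0 1 (by norm_num) (by norm_num) (by norm_num)

/-- The letters of the design are positive semidefinite (`c ≥ 1` for the lone letter `!![1, 1; 1, c]`, `A k > 0`). [folklore] -/
theorem letters_posSemidef {F : ℕ} {A : Fin F → ℝ} (hA : ∀ k, 0 < A k) {c : ℝ} (hc : 1 ≤ c) :
    ∀ k, ((Fin.cons (!![(1 : ℝ), 1; 1, c]) (fun k => !![(0 : ℝ), 0; 0, A k]) : Fin (F + 1) → Matrix (Fin 2) (Fin 2) ℝ) k).PosSemidef := by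
  intro k
  cases k using Fin.cases with
  | zero => simpa using PivotTwoFourWitness.posSemidef_two_of_entries 1 1 c (by norm_num) (by linarith) (by linarith)
  | succ k' => simpa using PivotTwoFourWitness.posSemidef_two_of_entries 0 0 (A k') le_rfl (hA k').le (by simp)

/-- The letters of the design are non-zero. [folklore] -/
theorem letters_ne_zero {F : ℕ} {A : Fin F → ℝ} (hA : ∀ k, 0 < A k) (c : ℝ) :
    ∀ k, ((Fin.cons (!![(1 : ℝ), 1; 1, c]) (fun k => !![(0 : ℝ), 0; 0, A k]) : Fin (F + 1) → Matrix (Fin 2) (Fin 2) ℝ) k) ≠ 0 := by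
  intro k
  cases k using Fin.cases with
  | zero => simp only [Fin.cons_zero]; intro h; have := congrFun (congrFun h 0) 0; simp at this
  | succ k' =>
    simp only [Fin.cons_succ]; intro h; have := congrFun (congrFun h 1) 1; simp at this; exact (hA k').ne' this

/-- The exponents `0 | 1 | D k ≥ 2` of the design are pairwise distinct. [folklore] -/
theorem exponents_injective {F : ℕ} {D : Fin F → ℕ} (hD : StrictAnti D) (hD2 : ∀ k, 2 ≤ D k) :
    Function.Injective (Fin.cons 0 D : Fin (F + 1) → ℕ) := by
  refine Fin.cons_injective_iff.2 ⟨?_, hD.injective⟩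
  rintro ⟨k, hk⟩
  have := hD2 k
  omega

/-- **THE OBLIQUE PARALLEL CLUSTER (rank-one lone letter): `2F` positive roots with `F` parallel upper letters.**  For every `F` there
are pairwise distinct exponents `D k ≥ 2` and amplitudes `A k > 0` such that the `2 × 2` pencil
`−t·1 + !![1,1;1,1] + ∑ₖ t^{D k} !![0,0;0,A k]` — NSD pivot at exponent `1`, RANK-ONE lone letter `(1,1)(1,1)ᵀ` below it, all upper
letters rank one and PARALLEL to `e₂` (oblique to the lone letter) — has at least `2F` distinct positive determinant roots. [folklore] -/
theorem exists_rankOne_design (F : ℕ) :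
    ∃ (D : Fin F → ℕ) (A : Fin F → ℝ), StrictAnti D ∧ (∀ k, 2 ≤ D k) ∧ (∀ k, 0 < A k) ∧
      2 * F ≤ pivotPosRoots 1 (Fin.cons 0 D : Fin (F + 1) → ℕ) (!![(-1 : ℝ), 0; 0, -1] : Matrix (Fin 2) (Fin 2) ℝ)
        (Fin.cons (!![(1 : ℝ), 1; 1, 1]) (fun k => !![(0 : ℝ), 0; 0, A k]) : Fin (F + 1) → Matrix (Fin 2) (Fin 2) ℝ) := by
  obtain ⟨D, A, τ, hD, hD2, hA, hτ, hτ0, _, hsign⟩ := exists_signed_certificate F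
  refine ⟨D, A, hD, hD2, hA, ?_⟩
  have halt := alternate_of_signed (g := fun t => (1 - t) * (∑ k, t ^ D k * A k) - t * (2 - t)) hsign
  refine le_pivotPosRoots_of_certificate (N := 2 * F) (f := fun t => (1 - t) * (∑ k, t ^ D k * A k) - t * (2 - t))
    (fun t => ?_) τ hτ hτ0 halt
  rw [show (!![(1 : ℝ), 1; 1, 1] : Matrix (Fin 2) (Fin 2) ℝ) = !![(1 : ℝ), 1; 1, 1 + 0] from by rw [add_zero], eval_det_design]
  ring

end Summit.ValiantsHypothesis.ValiantsHypothesis.Theorems.LacunarySymmetroidMatrixDescartes.Pivot.NsdLoneParallelDesign
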